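import Literature.AlgebraicGeometry.ModuliOfAbelianVarieties.Lan2013.Sec543HeckeCuspLabels
import Literature.Algebra.Module.LocalGlobalLattice
import HarnessLib

/-!
# [Lan2013PELCompactifications] §5.4.3 — theorem-only companion of `Sec543HeckeCuspLabels` (squad RULING TS-1)

DISCHARGES the named fact ★ `Lan2013_5437_integralPoints` (Lemma 5.4.3.7, book p. 370; 2010 rev. p. 414: «We have the relations
`GL_𝒪(X) = (GL(X ⊗ ℤ_{(□)}) ∩ GL_𝒪(X ⊗ 𝔸^{∞,□})) ∩ GL_𝒪(X ⊗ Ẑ^□)` …») in its ED. 2 letter (standing hypothesis: `□` a set of rational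
primes), over the concrete carriers ★ `Zhat box = Π_{p ∉ □} ℤ_p`, ★ `Afin box` (the localisation of `Ẑ^□` at the integers prime to `□`),
★ `GLO`, ★ `toAfin` ∕ `intToAfin`, ★ `IsBoxRationalGL`.  Architecture (print: «elementary lattice-theoretic statement»):
* `mem_GLO_iff` — membership in `GL_𝒪(X ⊗ R)` is commutation with the action matrices `actMatrix b`, `b ∈ 𝒪`; hence `GL_𝒪` is
  transported along ring maps (`map_mem_GLO`) and reflected through injective ones (`mem_GLO_of_map_mem`);
* `boxCoprimeSubmonoid_le_nonZeroDivisors`, `algebraMap_Afin_injective` — `Ẑ^□ ↪ 𝔸^{∞,□}` (each `n` prime to `□` is a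
  non-zero-divisor of `Π ℤ_p`); `intCast_Zhat_injective` — `ℤ ↪ Ẑ^□` as soon as one prime lies outside `□`;
* `exists_intCast_of_natCast_mul_eq` — **`ℤ_{(□)} ∩ Ẑ^□ = ℤ`**: `n a = z` in `Ẑ^□` with `□ ∤ n` forces `n ∣ z` (for each prime
  `q ∣ n`, `q ∉ □` and `‖z‖_q = ‖n‖_q ‖a_q‖_q ≤ q^{-v_q(n)}`, Mathlib `PadicInt.norm_int_le_pow_iff_dvd`) and then `a = z/n` by
  cancellation;
* `integralPoints_iff` — the assembly: entries of `g₂` and `g₂⁻¹` are integers, giving `γ ∈ GL_k(ℤ)`, `𝒪`-equivariant by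
  reflection; conversely integral matrices are `ℤ_{(□)}`-rational (`n = 1`, which is prime to `□` BECAUSE the members of `□` are primes —
  the ED. 2 guard, squad finding F-TM1) and `𝒪`-equivariance is transported.

**ED. 2 (append protocol; squad TS RULING TS-1 pay-down, typer TS-t17 (g2))** DISCHARGES ★ `Lan2013_5436_approximationGL` (the CLOSED
content of Lemma 5.4.3.6, book p. 370 = 2010 rev. p. 414, its printed proof: «we have the approximations
`GL(X ⊗ 𝔸^{∞,□}) = GL(X ⊗ ℤ_{(□)}) · GL(X ⊗ Ẑ^□)` … by elementary lattice theory»): every `g ∈ GL_k(𝔸^{∞,□})` is `g₁ · g₂` with `g₁`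
`ℤ_{(□)}`-rational together with its inverse (★ `IsBoxRationalGL`) and `g₂ ∈ GL_k(Ẑ^□)` (★ `toAfin`).  The «elementary lattice theory» is
NOT re-proved here: it is the tree's ★ `Literature.Algebra.Module.exists_rat_matrix_mem_integral_coset` (class number one of `GL_k` over
`ℚ` in local form — a system of local lattices `ℤ_p^k h_p`, almost all trivial, is `ℤ_p^k γ` for ONE `γ ∈ GL_k(ℚ)`: `γ = U_p h_p`,
`U_p ∈ GL_k(ℤ_p)` for every prime `p`; proved there from `Submodule.basisOfPid` over the PID `ℤ` and `p`-adic approximation).  Architecture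
of the transport to Lan's `Ẑ^□ = Π_{p ∉ □} ℤ_p` (★ `Zhat box`) and `𝔸^{∞,□}` (★ `Afin box`, the localisation at the integers prime to `□`):
* `exists_nat_eq_of_mem_boxCoprimeSubmonoid`, `exists_boxCoprime_denom` — one positive `N` with `□ ∤ N` such that `N g` and `N g⁻¹` are
  matrices `M`, `M′` over `Ẑ^□` (`M′ M = N² · 1`);
* `exists_ringHom_Afin_Qp` — the evaluations `e_p : 𝔸^{∞,□} → ℚ_p` (`p ∉ □`) extending ★ `toQp`; `afin_eq_zero_of_forall_eval_eq_zero` —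
  `𝔸^{∞,□} ↪ Π_{p ∉ □} ℚ_p`;
* the local family: `h_p := e_p(g⁻¹)` for `p ∉ □` (in `GL_k(ℤ_p)` once `p ∤ N`: `h_p = N⁻¹ M′_p`) and `h_p := 1` for `p ∈ □`; class number
  one gives `γ` and `U_p`; for `p ∈ □`, `γ = U_p ∈ GL_k(ℤ_p)`, so the entries of `γ^{±1}` have denominators prime to `□`
  (`not_dvd_den_of_norm_le_one`, `isBoxRational_of_forall_eval_eq`);
* `exists_boxRational_mul_integral` — `g₂ := (U_p)_{p ∉ □} ∈ GL_k(Ẑ^□)`, `g₁ := g g₂⁻¹`, whose evaluations are `e_p(g₁) = g_p U_p⁻¹ = γ⁻¹`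
  and `e_p(g₁⁻¹) = U_p (g⁻¹)_p = γ` for every `p ∉ □`; hence `g₁^{±1}` are `ℤ_{(□)}`-rational and `g = g₁ · g₂`.
Degenerate cases are uniform (no prime outside `□`: `Ẑ^□ = 0 = 𝔸^{∞,□}`, every statement is about the zero ring).  Standing hypothesis of
the ED. 2 letter kept: `□` a set of rational primes (it makes `1 ∈ boxCoprimeSubmonoid`'s generating set and `ℤ ⊂ ℤ_{(□)}` available).
No definition, no named fact, no sorry.  HC_CM is proved only modulo the printed citations until rung 0 closes.
-/

namespace Literature.AlgebraicGeometry.ModuliOfAbelianVarieties.Lan2013.Sec543HeckeCuspLabels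

open Matrix
open Literature.AlgebraicGeometry.ModuliOfAbelianVarieties.Lan2013
open Literature.AlgebraicGeometry.ModuliOfAbelianVarieties.Lan2013.Sec54CuspLabels

section GLOapi

variable {O : Type} [CommRing O] {X : Type} [AddCommGroup X] [Module O X] [Module.Free ℤ X] [Module.Finite ℤ X]

/-- Unfolding of ★ `commutingWith` (plumbing). [folklore] -/
private theorem mem_commutingWith_iff {R : Type} [CommRing R] {M : Type} [AddCommGroup M] [Module R M] (T : M →ₗ[R] M)
    (g : M ≃ₗ[R] M) : g ∈ commutingWith T ↔ g.toLinearMap ∘ₗ T = T ∘ₗ g.toLinearMap :=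
  Iff.rfl

/-- **Membership in `GL_𝒪(X ⊗ R)`** («the group of `𝒪 ⊗ R`-linear automorphisms», Def. 5.4.1.6) is commutation of the matrix with
every action matrix `actMatrix b`, `b ∈ 𝒪` (★ `GLO` is the closure-free intersection of the pull-backs of ★ `commutingWith`; the
comparison `mulVecLin` ↔ matrix product is Mathlib's `Matrix.toLin'`). [cite: Lan2013PELCompactifications, Def. 5.4.1.6 (§5.4.1, `GL_𝒪`; 2010 rev. p. 400)] -/
theorem mem_GLO_iff {R : Type} [CommRing R] (g : GL (Fin (rankL X)) R) :
    g ∈ GLO O X R ↔ ∀ b : O, (g : Matrix (Fin (rankL X)) (Fin (rankL X)) R) * (actMatrix O X b).map (Int.castRingHom R) =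
      (actMatrix O X b).map (Int.castRingHom R) * (g : Matrix (Fin (rankL X)) (Fin (rankL X)) R) := by
  unfold GLO
  simp only [Subgroup.mem_iInf, Subgroup.mem_comap, MonoidHom.coe_comp, Function.comp_apply, MulEquiv.coe_toMonoidHom]
  refine forall_congr' fun b => ?_
  rw [mem_commutingWith_iff]
  have key : ((g : Matrix _ _ R).mulVecLin ∘ₗ ((actMatrix O X b).map (Int.castRingHom R)).mulVecLin =
      ((actMatrix O X b).map (Int.castRingHom R)).mulVecLin ∘ₗ (g : Matrix _ _ R).mulVecLin) ↔
      (g : Matrix _ _ R) * (actMatrix O X b).map (Int.castRingHom R) =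
        (actMatrix O X b).map (Int.castRingHom R) * (g : Matrix _ _ R) := by
    rw [← Matrix.mulVecLin_mul, ← Matrix.mulVecLin_mul, ← Matrix.toLin'_apply', ← Matrix.toLin'_apply']
    exact Matrix.toLin'.injective.eq_iff
  exact key

/-- **`GL_𝒪` is transported along ring homomorphisms** `R → S` (the maps `GL_𝒪(X) → GL_𝒪(X ⊗ Ẑ^□) → GL_𝒪(X ⊗ 𝔸^{∞,□})` of
Lem. 5.4.3.7 land in `GL_𝒪`). [cite: Lan2013PELCompactifications, Def. 5.4.1.6 (§5.4.1, `GL_𝒪`; 2010 rev. p. 400)] -/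
theorem map_mem_GLO {R S : Type} [CommRing R] [CommRing S] (f : R →+* S) {g : GL (Fin (rankL X)) R} (hg : g ∈ GLO O X R) :
    Matrix.GeneralLinearGroup.map f g ∈ GLO O X S := by
  rw [mem_GLO_iff] at hg ⊢
  intro b
  have hA : ((actMatrix O X b).map (Int.castRingHom R)).map f = (actMatrix O X b).map (Int.castRingHom S) := by
    rw [Matrix.map_map]
    congr 1
    funext x
    simp
  have h := congrArg (fun M : Matrix (Fin (rankL X)) (Fin (rankL X)) R => M.map f) (hg b)
  simp only [Matrix.map_mul, hA] at h
  exact h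

/-- **`GL_𝒪` is reflected through injective ring homomorphisms**: if the image of `g` over `S ⊇ R` commutes with `𝒪`, so does
`g`. [cite: Lan2013PELCompactifications, Def. 5.4.1.6 (§5.4.1, `GL_𝒪`; 2010 rev. p. 400)] -/
theorem mem_GLO_of_map_mem {R S : Type} [CommRing R] [CommRing S] (f : R →+* S) (hf : Function.Injective f)
    {g : GL (Fin (rankL X)) R} (hg : Matrix.GeneralLinearGroup.map f g ∈ GLO O X S) : g ∈ GLO O X R := by
  rw [mem_GLO_iff] at hg ⊢
  intro b
  have hA : ((actMatrix O X b).map (Int.castRingHom R)).map f = (actMatrix O X b).map (Int.castRingHom S) := by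
    rw [Matrix.map_map]
    congr 1
    funext x
    simp
  have h := hg b
  have e1 : ((Matrix.GeneralLinearGroup.map f g : GL (Fin (rankL X)) S) : Matrix (Fin (rankL X)) (Fin (rankL X)) S) =
      (g : Matrix (Fin (rankL X)) (Fin (rankL X)) R).map f := rfl
  rw [e1, ← hA, ← Matrix.map_mul, ← Matrix.map_mul] at h
  exact Matrix.map_injective hf h

end GLOapi

section ZhatArith

variable (box : Set ℕ)

/-- A positive integer is a non-zero-divisor of `Ẑ^□ = Π_{p ∉ □} ℤ_p` (each `ℤ_p` is a domain of characteristic `0`). [cite: Lan2013PELCompactifications, Def. 1.4.1.1 (p. 79, `Ẑ^□`) and §5.4.3 (2010 rev. p. 414, `Ẑ^□ ⊂ 𝔸^{∞,□}`)] -/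
theorem natCast_mem_nonZeroDivisors {n : ℕ} (hn : 0 < n) : (n : Zhat box) ∈ nonZeroDivisors (Zhat box) := by
  rw [mem_nonZeroDivisors_iff]
  refine ⟨fun x hx => ?_, fun x hx => ?_⟩
  · funext p
    have := congr_fun hx p
    simp only [Pi.mul_apply, Pi.natCast_apply, Pi.zero_apply, mul_eq_zero, Nat.cast_eq_zero] at this
    exact this.resolve_left (Nat.pos_iff_ne_zero.mp hn)
  · funext p
    have := congr_fun hx p
    simp only [Pi.mul_apply, Pi.natCast_apply, Pi.zero_apply, mul_eq_zero, Nat.cast_eq_zero] at this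
    exact this.resolve_right (Nat.pos_iff_ne_zero.mp hn)

/-- The denominators of `𝔸^{∞,□}` over `Ẑ^□` (★ `boxCoprimeSubmonoid`) are non-zero-divisors. [cite: Lan2013PELCompactifications, Def. 1.4.1.1 (p. 79, `Ẑ^□`) and §5.4.3 (2010 rev. p. 414, `Ẑ^□ ⊂ 𝔸^{∞,□}`)] -/
theorem boxCoprimeSubmonoid_le_nonZeroDivisors : boxCoprimeSubmonoid box ≤ nonZeroDivisors (Zhat box) := by
  unfold boxCoprimeSubmonoid
  rw [Submonoid.closure_le]
  rintro _ ⟨n, ⟨hn, -⟩, rfl⟩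
  exact natCast_mem_nonZeroDivisors box hn

/-- **`Ẑ^□ ↪ 𝔸^{∞,□}`**: the structure map of the localisation ★ `Afin box` is injective. [cite: Lan2013PELCompactifications, Def. 1.4.1.1 (p. 79, `Ẑ^□`) and §5.4.3 (2010 rev. p. 414, `Ẑ^□ ⊂ 𝔸^{∞,□}`)] -/
theorem algebraMap_Afin_injective : Function.Injective (algebraMap (Zhat box) (Afin box)) :=
  IsLocalization.injective (Afin box) (boxCoprimeSubmonoid_le_nonZeroDivisors box)

/-- **`ℤ ↪ Ẑ^□`** as soon as some prime lies outside `□` (for `□ ⊇` all primes, `Ẑ^□ = 0`). [cite: Lan2013PELCompactifications, Def. 1.4.1.1 (p. 79, `Ẑ^□`) and §5.4.3 (2010 rev. p. 414, `Ẑ^□ ⊂ 𝔸^{∞,□}`)] -/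
theorem intCast_Zhat_injective [Nonempty (GoodPrime box)] : Function.Injective (Int.cast : ℤ → Zhat box) := by
  intro a b h
  obtain ⟨p⟩ := ‹Nonempty (GoodPrime box)›
  have := congr_fun h p
  simp only [Pi.intCast_apply] at this
  exact_mod_cast this

/-- **`ℤ_{(□)} ∩ Ẑ^□ = ℤ` inside `𝔸^{∞,□}`, elementwise**: if `n · a = z` in `Ẑ^□` with `z ∈ ℤ` and `□ ∤ n`, then `n ∣ z` (every prime
factor `q` of `n` lies outside `□`, and `‖z‖_q ≤ ‖n‖_q`) and `a` is the integer `z / n` — the «elementary lattice-theoretic» content of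
Lem. 5.4.3.7. [cite: Lan2013PELCompactifications, Lem. 5.4.3.7, proof (p. 370; 2010 rev. p. 414)] -/
theorem exists_intCast_of_natCast_mul_eq {n : ℕ} (hn : 0 < n) (hcop : BoxCoprime box n) {a : Zhat box} {z : ℤ}
    (h : (n : Zhat box) * a = (z : Zhat box)) : ∃ w : ℤ, a = (w : Zhat box) := by
  have hdvd : (n : ℤ) ∣ z := by
    rcases eq_or_ne z 0 with rfl | hz
    · exact dvd_zero _
    rw [Int.natCast_dvd, ← Nat.factorization_prime_le_iff_dvd hn.ne' (Int.natAbs_ne_zero.mpr hz)]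
    intro q hq
    by_cases hqn : q ∣ n
    · have hqbox : q ∉ box := fun hmem => hcop q hmem hqn
      let P : GoodPrime box := ⟨q, hq, hqbox⟩
      haveI : Fact q.Prime := ⟨hq⟩
      have hcomp : ((n : ℤ) : ℤ_[q]) * a P = (z : ℤ_[q]) := by
        have := congr_fun h P
        simpa [Pi.mul_apply, Pi.natCast_apply, Pi.intCast_apply] using this
      have h1 : ‖((n : ℤ) : ℤ_[q])‖ ≤ (q : ℝ) ^ (-(n.factorization q : ℤ)) := by
        rw [PadicInt.norm_int_le_pow_iff_dvd]
        exact_mod_cast Nat.ordProj_dvd n q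
      have h2 : ‖(z : ℤ_[q])‖ ≤ (q : ℝ) ^ (-(n.factorization q : ℤ)) := by
        rw [← hcomp, norm_mul]
        calc ‖((n : ℤ) : ℤ_[q])‖ * ‖a P‖ ≤ ‖((n : ℤ) : ℤ_[q])‖ * 1 := by
              gcongr
              exact PadicInt.norm_le_one _
          _ ≤ (q : ℝ) ^ (-(n.factorization q : ℤ)) := by rw [mul_one]; exact h1
      have h3 : ((q ^ n.factorization q : ℕ) : ℤ) ∣ z := by
        have := PadicInt.norm_int_le_pow_iff_dvd.mp h2
        exact_mod_cast this
      rw [Int.natCast_dvd] at h3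
      exact (hq.pow_dvd_iff_le_factorization (Int.natAbs_ne_zero.mpr hz)).mp h3
    · rw [Nat.factorization_eq_zero_of_not_dvd hqn]
      exact Nat.zero_le _
  obtain ⟨w, hw⟩ := hdvd
  refine ⟨w, ?_⟩
  have hnz := natCast_mem_nonZeroDivisors box hn
  have e : (n : Zhat box) * a = (n : Zhat box) * (w : Zhat box) := by
    rw [h, hw]
    push_cast
    rfl
  exact (mul_cancel_left_mem_nonZeroDivisors hnz).mp e

/-- An element of `Ẑ^□` whose image in `𝔸^{∞,□}` is `ℤ_{(□)}`-rational (★ `IsBoxRational`) is an integer. [cite: Lan2013PELCompactifications, Lem. 5.4.3.7, proof (p. 370; 2010 rev. p. 414)] -/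
theorem exists_intCast_of_isBoxRational {a : Zhat box} (ha : IsBoxRational box (algebraMap (Zhat box) (Afin box) a)) :
    ∃ w : ℤ, a = (w : Zhat box) := by
  obtain ⟨n, hn, hcop, z, hz⟩ := ha
  refine exists_intCast_of_natCast_mul_eq box hn hcop (z := z) (algebraMap_Afin_injective box ?_)
  rw [map_mul, map_natCast, map_intCast]
  exact hz

end ZhatArith

section Assembly

variable (box : Set ℕ)

/-- `□ ∤ 1` when the members of `□` are primes (plumbing for the ED. 2 guard). [folklore] -/
private theorem boxCoprime_one (hbox : ∀ p ∈ box, p.Prime) : BoxCoprime box 1 :=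
  fun p hp h1 => (hbox p hp).ne_one (Nat.dvd_one.mp h1)

/-- Integers are `ℤ_{(□)}`-rational (denominator `1`; plumbing). [folklore] -/
private theorem isBoxRational_intCast (hbox : ∀ p ∈ box, p.Prime) (w : ℤ) : IsBoxRational box (w : Afin box) :=
  ⟨1, Nat.one_pos, boxCoprime_one box hbox, w, by simp⟩

/-- `ℤ → Ẑ^□ → 𝔸^{∞,□}` is `ℤ → 𝔸^{∞,□}` on `GL_k` (plumbing, `RingHom.ext_int`). [folklore] -/
private theorem toAfin_map_intCast (k : ℕ) (γ : GL (Fin k) ℤ) :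
    toAfin box k (Matrix.GeneralLinearGroup.map (Int.castRingHom (Zhat box)) γ) = intToAfin box k γ := by
  unfold toAfin intToAfin
  rw [← Matrix.GeneralLinearGroup.map_comp_apply, ← Matrix.GeneralLinearGroup.map_comp,
    RingHom.ext_int ((algebraMap (Zhat box) (Afin box)).comp (Int.castRingHom (Zhat box))) (Int.castRingHom (Afin box))]

variable {O : Type} [CommRing O] {X : Type} [AddCommGroup X] [Module O X] [Module.Free ℤ X] [Module.Finite ℤ X]

/-- **Lemma 5.4.3.7 over the concrete `Ẑ^□`, `𝔸^{∞,□}`** (the body of ★ `Lan2013_5437_integralPoints`, ED. 2 letter, with its binders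
explicit): an element of `GL(X ⊗ 𝔸^{∞,□})` comes from `GL_𝒪(X)` iff it is `ℤ_{(□)}`-rational with its inverse, commutes with `𝒪`, and comes
from `GL_𝒪(X ⊗ Ẑ^□)`. [cite: Lan2013PELCompactifications, Lem. 5.4.3.7, proof (p. 370; 2010 rev. p. 414)] -/
theorem integralPoints_iff (hbox : ∀ p ∈ box, p.Prime) (g : GL (Fin (rankL X)) (Afin box)) :
    (∃ γ ∈ GLO O X ℤ, intToAfin box (rankL X) γ = g) ↔
      (IsBoxRationalGL box g ∧ g ∈ GLO O X (Afin box) ∧ ∃ g₂ ∈ GLO O X (Zhat box), toAfin box (rankL X) g₂ = g) := by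
  constructor
  · rintro ⟨γ, hγ, rfl⟩
    refine ⟨fun i i' => ⟨?_, ?_⟩, map_mem_GLO _ hγ,
      Matrix.GeneralLinearGroup.map (Int.castRingHom (Zhat box)) γ, map_mem_GLO _ hγ, toAfin_map_intCast box _ γ⟩
    · unfold intToAfin
      rw [Matrix.GeneralLinearGroup.map_apply]
      exact isBoxRational_intCast box hbox _
    · unfold intToAfin
      rw [← Matrix.GeneralLinearGroup.map_inv, Matrix.GeneralLinearGroup.map_apply]
      exact isBoxRational_intCast box hbox _
  · rintro ⟨hrat, -, g₂, hg₂, rfl⟩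
    rcases isEmpty_or_nonempty (GoodPrime box) with hE | hN
    · -- no prime outside `□`: `Ẑ^□ = 0`, everything is trivial
      refine ⟨1, one_mem _, ?_⟩
      rw [← toAfin_map_intCast]
      congr 1
      refine Matrix.GeneralLinearGroup.ext fun i i' => ?_
      exact Subsingleton.elim _ _
    · -- entries of `g₂` and `g₂⁻¹` are integers
      have hW : ∀ i i', ∃ w : ℤ, (g₂ : Matrix (Fin (rankL X)) (Fin (rankL X)) (Zhat box)) i i' = (w : Zhat box) := fun i i' => by
        refine exists_intCast_of_isBoxRational box ?_
        have := (hrat i i').1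
        rwa [toAfin, Matrix.GeneralLinearGroup.map_apply] at this
      have hW' : ∀ i i', ∃ w : ℤ, ((g₂⁻¹ : GL (Fin (rankL X)) (Zhat box)) : Matrix (Fin (rankL X)) (Fin (rankL X)) (Zhat box)) i i' =
          (w : Zhat box) := fun i i' => by
        refine exists_intCast_of_isBoxRational box ?_
        have := (hrat i i').2
        rwa [toAfin, ← Matrix.GeneralLinearGroup.map_inv, Matrix.GeneralLinearGroup.map_apply] at this
      choose W hW using hW
      choose W' hW' using hW'
      have hinj := intCast_Zhat_injective box
      have hmapW : (Matrix.of fun i i' => W i i').map (Int.castRingHom (Zhat box)) =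
          (g₂ : Matrix (Fin (rankL X)) (Fin (rankL X)) (Zhat box)) := by
        ext i i'
        simp [hW i i']
      have hmapW' : (Matrix.of fun i i' => W' i i').map (Int.castRingHom (Zhat box)) =
          ((g₂⁻¹ : GL (Fin (rankL X)) (Zhat box)) : Matrix (Fin (rankL X)) (Fin (rankL X)) (Zhat box)) := by
        ext i i'
        simp [hW' i i']
      have h1 : (Matrix.of fun i i' => W i i') * (Matrix.of fun i i' => W' i i') = 1 := by
        apply Matrix.map_injective hinj
        show ((Matrix.of fun i i' => W i i') * (Matrix.of fun i i' => W' i i')).map (Int.castRingHom (Zhat box)) =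
          (1 : Matrix (Fin (rankL X)) (Fin (rankL X)) ℤ).map (Int.castRingHom (Zhat box))
        rw [Matrix.map_mul, hmapW, hmapW', Matrix.map_one (Int.castRingHom (Zhat box)) (map_zero _) (map_one _)]
        exact Units.mul_inv g₂
      have h2 : (Matrix.of fun i i' => W' i i') * (Matrix.of fun i i' => W i i') = 1 := by
        apply Matrix.map_injective hinj
        show ((Matrix.of fun i i' => W' i i') * (Matrix.of fun i i' => W i i')).map (Int.castRingHom (Zhat box)) =
          (1 : Matrix (Fin (rankL X)) (Fin (rankL X)) ℤ).map (Int.castRingHom (Zhat box))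
        rw [Matrix.map_mul, hmapW, hmapW', Matrix.map_one (Int.castRingHom (Zhat box)) (map_zero _) (map_one _)]
        exact Units.inv_mul g₂
      let γ : GL (Fin (rankL X)) ℤ := ⟨_, _, h1, h2⟩
      have hγ : Matrix.GeneralLinearGroup.map (Int.castRingHom (Zhat box)) γ = g₂ :=
        Matrix.GeneralLinearGroup.ext fun i i' => by
          rw [Matrix.GeneralLinearGroup.map_apply]
          exact (congr_fun (congr_fun hmapW i) i' : _)
      refine ⟨γ, mem_GLO_of_map_mem (Int.castRingHom (Zhat box)) hinj (by rw [hγ]; exact hg₂), ?_⟩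
      rw [← toAfin_map_intCast, hγ]

end Assembly

/-- **Lemma 5.4.3.7 DISCHARGED** (RULING TS-1 pay-down of ★ `Lan2013_5437_integralPoints`, ED. 2 letter with print's standing hypothesis
«`□` a set of rational primes»): `GL_𝒪(X) = (GL(X ⊗ ℤ_{(□)}) ∩ GL_𝒪(X ⊗ 𝔸^{∞,□})) ∩ GL_𝒪(X ⊗ Ẑ^□)` inside `GL(X ⊗ 𝔸^{∞,□})`.  Proof as in print
(«elementary», p. 370): `ℤ_{(□)} ∩ Ẑ^□ = ℤ` entrywise (`exists_intCast_of_natCast_mul_eq`: a prime factor `q` of the denominator lies outside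
`□`, and `‖z‖_q ≤ ‖n‖_q` forces `q^{v_q(n)} ∣ z`), applied to the entries of `g` and `g⁻¹`; `𝒪`-equivariance descends along the injection
`ℤ ↪ Ẑ^□` (`mem_GLO_of_map_mem`); the degenerate case `Ẑ^□ = 0` (no prime outside `□`) is the trivial group.
[cite: Lan2013PELCompactifications, Lem. 5.4.3.7 (p. 370; 2010 rev. p. 414)] -/
theorem Lan2013_5437_integralPoints_holds : Lan2013_5437_integralPoints := by
  intro box hbox O _ X _ _ _ _ _ g
  exact integralPoints_iff box hbox g

/-! ## ED. 2 — Lemma 5.4.3.6: `GL_k(𝔸^{∞,□}) = GL_k(ℤ_{(□)}) · GL_k(Ẑ^□)` (discharge of ★ `Lan2013_5436_approximationGL`) -/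

section Approximation5436

variable (box : Set ℕ)

/-- Members of ★ `boxCoprimeSubmonoid` (the denominators of `𝔸^{∞,□}` over `Ẑ^□`) are the images of positive integers prime to `□` — when
`□` consists of primes (print's standing hypothesis, Def. 1.4.1.1; for `1 ∈ □` the generating set is empty). [cite: Lan2013PELCompactifications, §5.4.3 (2010 rev. p. 414, `Ẑ^□ ⊂ 𝔸^{∞,□}`) and Def. 1.4.1.1 (p. 79)] -/
theorem exists_nat_eq_of_mem_boxCoprimeSubmonoid (hbox : ∀ p ∈ box, p.Prime) {s : Zhat box}
    (hs : s ∈ boxCoprimeSubmonoid box) : ∃ n : ℕ, 0 < n ∧ BoxCoprime box n ∧ (n : Zhat box) = s := by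
  unfold boxCoprimeSubmonoid at hs
  induction hs using Submonoid.closure_induction with
  | mem x hx =>
    obtain ⟨n, ⟨hn, hcop⟩, rfl⟩ := hx
    exact ⟨n, hn, hcop, rfl⟩
  | one => exact ⟨1, Nat.one_pos, fun p hp h1 => (hbox p hp).ne_one (Nat.dvd_one.mp h1), by simp⟩
  | mul x y _ _ ihx ihy =>
    obtain ⟨m, hm, hmc, rfl⟩ := ihx
    obtain ⟨n, hn, hnc, rfl⟩ := ihy
    refine ⟨m * n, Nat.mul_pos hm hn, fun p hp hdvd => ?_, by push_cast; rfl⟩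
    rcases (hbox p hp).dvd_mul.mp hdvd with h | h
    · exact hmc p hp h
    · exact hnc p hp h

/-- **Common `□`-coprime denominator**: finitely many elements of `𝔸^{∞,□} = Ẑ^□ ⊗ ℚ` become integral (lie in `Ẑ^□`) after multiplication
by one positive integer `N` with `□ ∤ N` (Mathlib `IsLocalization.exist_integer_multiples_of_finite`; print: «`GL(X ⊗ ℤ_{(□)})`» inside
`GL(X ⊗ 𝔸^{∞,□})`). [cite: Lan2013PELCompactifications, §5.4.3 (2010 rev. p. 414, `Ẑ^□ ⊂ 𝔸^{∞,□}`) and Def. 1.4.1.1 (p. 79)] -/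
theorem exists_boxCoprime_denom (hbox : ∀ p ∈ box, p.Prime) {ι : Type} [Finite ι] (f : ι → Afin box) :
    ∃ N : ℕ, 0 < N ∧ BoxCoprime box N ∧ ∀ i, ∃ x : Zhat box, algebraMap (Zhat box) (Afin box) x = (N : Afin box) * f i := by
  obtain ⟨b, hb⟩ := IsLocalization.exist_integer_multiples_of_finite (boxCoprimeSubmonoid box) f
  obtain ⟨N, hN, hcop, hNb⟩ := exists_nat_eq_of_mem_boxCoprimeSubmonoid box hbox b.2
  refine ⟨N, hN, hcop, fun i => ?_⟩
  obtain ⟨x, hx⟩ := hb i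
  refine ⟨x, ?_⟩
  rw [hx, Algebra.smul_def, ← hNb, map_natCast]

/-- **The evaluation `𝔸^{∞,□} → ℚ_p` at a prime `p ∉ □`**, the ring homomorphism extending the `p`-component `Ẑ^□ → ℤ_p ⊂ ℚ_p` (★ `toQp`):
the denominators are non-zero-divisors of `Π ℤ_q`, so their `p`-components are non-zero, i.e. invertible in `ℚ_p` (`IsLocalization.lift`).
[cite: Lan2013PELCompactifications, Def. 1.4.1.8 (p. 82, the components `g_p` of `G(Ẑ^□)`) and §5.4.3 (2010 rev. p. 414)] -/
theorem exists_ringHom_Afin_Qp (P : GoodPrime box) :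
    ∃ e : Afin box →+* Qp box P, ∀ x : Zhat box, e (algebraMap (Zhat box) (Afin box) x) = toQp box P x := by
  haveI : Fact P.1.Prime := ⟨P.2.1⟩
  have hunit : ∀ y : boxCoprimeSubmonoid box, IsUnit (toQp box P y) := by
    intro y
    have hy : (y : Zhat box) ∈ nonZeroDivisors (Zhat box) := boxCoprimeSubmonoid_le_nonZeroDivisors box y.2
    rw [isUnit_iff_ne_zero]
    intro h0
    have hcomp : (y : Zhat box) P = 0 := by
      have : ((((y : Zhat box) P : Zp box P)) : Qp box P) = 0 := by
        simpa [toQp] using h0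
      exact PadicInt.coe_eq_zero.mp this
    -- `y · e_P = 0` with `e_P ≠ 0` contradicts `y` being a non-zero-divisor
    have hzero := (mem_nonZeroDivisors_iff.mp hy).1 (Pi.single P 1) (by
      funext Q
      by_cases hQ : Q = P
      · subst hQ; simp [hcomp]
      · simp [hQ])
    have := congr_fun hzero P
    simp at this
  exact ⟨IsLocalization.lift (M := boxCoprimeSubmonoid box) hunit, fun x => IsLocalization.lift_eq hunit x⟩

/-- **`𝔸^{∞,□} ↪ Π_{p ∉ □} ℚ_p`**: an element of `𝔸^{∞,□}` killed by every evaluation at a prime outside `□` is zero (write it as `x / s`;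
all components of `x ∈ Ẑ^□ = Π_{p ∉ □} ℤ_p` vanish). [cite: Lan2013PELCompactifications, Def. 1.4.1.1 (p. 79, `Ẑ^□`) and §5.4.3 (2010 rev. p. 414, `Ẑ^□ ⊂ 𝔸^{∞,□}`)] -/
theorem afin_eq_zero_of_forall_eval_eq_zero (e : ∀ P : GoodPrime box, Afin box →+* Qp box P)
    (he : ∀ P x, e P (algebraMap (Zhat box) (Afin box) x) = toQp box P x) (a : Afin box) (ha : ∀ P, e P a = 0) :
    a = 0 := by
  obtain ⟨⟨x, s⟩, rfl⟩ := IsLocalization.mk'_surjective (boxCoprimeSubmonoid box) a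
  change IsLocalization.mk' (Afin box) x s = 0
  replace ha : ∀ P, e P (IsLocalization.mk' (Afin box) x s) = 0 := ha
  have hx : x = 0 := by
    funext P
    haveI : Fact P.1.Prime := ⟨P.2.1⟩
    have h1 : e P (IsLocalization.mk' (Afin box) x s) * e P (algebraMap (Zhat box) (Afin box) s) = toQp box P x := by
      rw [← map_mul, IsLocalization.mk'_spec, he]
    rw [ha P, zero_mul] at h1
    have : (((x P : Zp box P)) : Qp box P) = 0 := by simpa [toQp] using h1.symm
    exact PadicInt.coe_eq_zero.mp this
  rw [hx, IsLocalization.mk'_zero]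

/-- A rational number which is a `p`-adic integer has denominator prime to `p`. [folklore] -/
private theorem not_dvd_den_of_norm_le_one {p : ℕ} [Fact p.Prime] {r : ℚ} (hr : ‖(r : ℚ_[p])‖ ≤ 1) : ¬ p ∣ r.den := by
  intro hdvd
  have hp : p.Prime := Fact.out
  have hnum : ¬ (p : ℤ) ∣ r.num := by
    intro h
    have h' : p ∣ r.num.natAbs := Int.natCast_dvd.mp h
    have c1 : p.Coprime r.den := Nat.Coprime.coprime_dvd_left h' r.reduced
    have c2 : p.Coprime p := Nat.Coprime.coprime_dvd_right hdvd c1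
    have c3 : Nat.gcd p p = 1 := c2
    rw [Nat.gcd_self] at c3
    exact hp.ne_one c3
  have h1 : ‖(r.num : ℚ_[p])‖ = 1 :=
    le_antisymm (Padic.norm_int_le_one _) (not_lt.mp (mt Padic.norm_intCast_lt_one_iff.mp hnum))
  have h2 : ‖((r.den : ℤ) : ℚ_[p])‖ < 1 := Padic.norm_intCast_lt_one_iff.mpr (by exact_mod_cast hdvd)
  have hden0 : ((r.den : ℤ) : ℚ_[p]) ≠ 0 := by exact_mod_cast r.den_ne_zero
  have hr' : (r : ℚ_[p]) = (r.num : ℚ_[p]) / ((r.den : ℤ) : ℚ_[p]) := by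
    rw [Rat.cast_def]; push_cast; rfl
  rw [hr', norm_div, h1] at hr
  have hpos : 0 < ‖((r.den : ℤ) : ℚ_[p])‖ := norm_pos_iff.mpr hden0
  have : 1 < 1 / ‖((r.den : ℤ) : ℚ_[p])‖ := by
    rw [lt_div_iff₀ hpos, one_mul]; exact h2
  linarith

/-- An element of `𝔸^{∞,□}` all of whose evaluations at the primes outside `□` equal one rational number `r` with denominator prime to
`□` is `ℤ_{(□)}`-rational (★ `IsBoxRational` — «`GL(X ⊗ ℤ_{(□)})`» read inside `GL(X ⊗ 𝔸^{∞,□})` — witnessed by `r.den · a = r.num`).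
[cite: Lan2013PELCompactifications, Lem. 5.4.3.6 (p. 370; 2010 rev. p. 414)] -/
theorem isBoxRational_of_forall_eval_eq (e : ∀ P : GoodPrime box, Afin box →+* Qp box P)
    (he : ∀ P x, e P (algebraMap (Zhat box) (Afin box) x) = toQp box P x) {a : Afin box} {r : ℚ}
    (hden : BoxCoprime box r.den) (ha : ∀ P, e P a = (r : Qp box P)) : IsBoxRational box a := by
  refine ⟨r.den, r.den_pos, hden, r.num, ?_⟩
  have h0 : (r.den : Afin box) * a - (r.num : Afin box) = 0 :=
    afin_eq_zero_of_forall_eval_eq_zero box e he _ fun P => by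
      haveI : Fact P.1.Prime := ⟨P.2.1⟩
      rw [map_sub, map_mul, map_natCast, map_intCast, ha P, sub_eq_zero]
      exact_mod_cast Rat.den_mul_eq_num r
  exact sub_eq_zero.mp h0

/-- Matrices over `Ẑ^□ = Π_{p ∉ □} ℤ_p` agree as soon as their `p`-components agree (plumbing). [folklore] -/
private theorem matrix_eq_of_forall_component_eq {k : ℕ} {M M' : Matrix (Fin k) (Fin k) (Zhat box)}
    (h : ∀ P : GoodPrime box, M.map (Pi.evalRingHom (fun q : GoodPrime box => Zp box q) P) =
      M'.map (Pi.evalRingHom (fun q : GoodPrime box => Zp box q) P)) : M = M' := by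
  ext i j P
  exact (congr_fun (congr_fun (h P) i) j : _)

/-- **`GL_k(𝔸^{∞,□}) = GL_k(ℤ_{(□)}) · GL_k(Ẑ^□)`** (the body of ★ `Lan2013_5436_approximationGL` with its binders explicit): every
`g ∈ GL_k(𝔸^{∞,□})` is `g₁ · g₂` with `g₁` `ℤ_{(□)}`-rational together with its inverse and `g₂ ∈ GL_k(Ẑ^□)`.  PROOF: class number one of
`GL_k` over `ℚ` in its local form ★ `Literature.Algebra.Module.exists_rat_matrix_mem_integral_coset` («elementary lattice theory»: a system
of local lattices `ℤ_p^k g_p`, almost all trivial, is `ℤ_p^k γ` for one `γ ∈ GL_k(ℚ)`), applied to the components `(g⁻¹)_p` at the primes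
`p ∉ □` and to `1` at `p ∈ □`; then `γ ∈ GL_k(ℤ_p)` for `p ∈ □` (so `γ^{±1}` are `ℤ_{(□)}`-rational), `U := (γ g_p)_{p ∉ □} ∈ GL_k(Ẑ^□)`, and
`g = (g U⁻¹) · U` with `(g U⁻¹)_p = γ⁻¹` for every `p ∉ □` (`𝔸^{∞,□} ↪ Π_{p ∉ □} ℚ_p`).
[cite: Lan2013PELCompactifications, Lem. 5.4.3.6, proof (p. 370; 2010 rev. p. 414)] -/
theorem exists_boxRational_mul_integral (hbox : ∀ p ∈ box, p.Prime) (k : ℕ) (g : GL (Fin k) (Afin box)) :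
    ∃ g₁ : GL (Fin k) (Afin box), IsBoxRationalGL box g₁ ∧ ∃ g₂ : GL (Fin k) (Zhat box), g = g₁ * toAfin box k g₂ := by
  classical
  -- the evaluations `𝔸^{∞,□} → ℚ_p`, `p ∉ □`
  choose ev hev using exists_ringHom_Afin_Qp box
  have hev' : ∀ (P : GoodPrime box) (y : Zhat box), ev P (algebraMap (Zhat box) (Afin box) y) = ((y P : Zp box P) : Qp box P) :=
    fun P y => by rw [hev]; rfl
  -- a common `□`-coprime denominator `N` of the entries of `g` and `g⁻¹`
  obtain ⟨N, hN, hcop, hint⟩ := exists_boxCoprime_denom box hbox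
    (fun x : (Fin k × Fin k) ⊕ (Fin k × Fin k) =>
      Sum.elim (fun ij => (g : Matrix (Fin k) (Fin k) (Afin box)) ij.1 ij.2)
        (fun ij => ((g⁻¹ : GL (Fin k) (Afin box)) : Matrix (Fin k) (Fin k) (Afin box)) ij.1 ij.2) x)
  choose x hx using hint
  let M : Matrix (Fin k) (Fin k) (Zhat box) := Matrix.of fun i j => x (Sum.inl (i, j))
  let M' : Matrix (Fin k) (Fin k) (Zhat box) := Matrix.of fun i j => x (Sum.inr (i, j))
  have hM : ∀ i j, algebraMap (Zhat box) (Afin box) (M i j) = (N : Afin box) * (g : Matrix (Fin k) (Fin k) (Afin box)) i j :=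
    fun i j => hx (Sum.inl (i, j))
  have hM' : ∀ i j, algebraMap (Zhat box) (Afin box) (M' i j) =
      (N : Afin box) * ((g⁻¹ : GL (Fin k) (Afin box)) : Matrix (Fin k) (Fin k) (Afin box)) i j :=
    fun i j => hx (Sum.inr (i, j))
  have hM'M : M' * M = Matrix.diagonal (fun _ : Fin k => (N : Zhat box) * N) := by
    have h1 : ((g⁻¹ : GL (Fin k) (Afin box)) : Matrix (Fin k) (Fin k) (Afin box)) * (g : Matrix (Fin k) (Fin k) (Afin box)) = 1 :=
      Units.inv_mul g
    refine Matrix.ext fun i j => algebraMap_Afin_injective box ?_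
    have h2 := congr_fun (congr_fun h1 i) j
    rw [Matrix.mul_apply] at h2
    rw [Matrix.mul_apply, map_sum]
    simp_rw [map_mul, hM, hM']
    calc ∑ l, (N : Afin box) * ((g⁻¹ : GL (Fin k) (Afin box)) : Matrix (Fin k) (Fin k) (Afin box)) i l *
          ((N : Afin box) * (g : Matrix (Fin k) (Fin k) (Afin box)) l j)
        = (N : Afin box) * N * ∑ l, ((g⁻¹ : GL (Fin k) (Afin box)) : Matrix (Fin k) (Fin k) (Afin box)) i l *
            (g : Matrix (Fin k) (Fin k) (Afin box)) l j := by
          rw [Finset.mul_sum]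
          exact Finset.sum_congr rfl fun l _ => by ring
      _ = algebraMap (Zhat box) (Afin box) (Matrix.diagonal (fun _ : Fin k => (N : Zhat box) * N) i j) := by
          rw [h2, Matrix.diagonal_apply, Matrix.one_apply]
          by_cases hij : i = j
          · simp [hij]
          · simp [hij]
  -- the local family: `(g⁻¹)_p` at `p ∉ □`, `1` at `p ∈ □`
  let h : ∀ (p : ℕ) [Fact p.Prime], Matrix (Fin k) (Fin k) ℚ_[p] := fun p _ =>
    if hp : p ∉ box then
      ((g⁻¹ : GL (Fin k) (Afin box)) : Matrix (Fin k) (Fin k) (Afin box)).map (ev ⟨p, Fact.out, hp⟩)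
    else 1
  have h_good : ∀ (p : ℕ) [Fact p.Prime] (hp : p ∉ box),
      h p = ((g⁻¹ : GL (Fin k) (Afin box)) : Matrix (Fin k) (Fin k) (Afin box)).map (ev ⟨p, Fact.out, hp⟩) :=
    fun p _ hp => dif_pos hp
  have h_bad : ∀ (p : ℕ) [Fact p.Prime], p ∈ box → h p = 1 := fun p _ hp => dif_neg (not_not.mpr hp)
  -- `(g⁻¹)_p (g)_p = 1`
  have hinvmul : ∀ (P : GoodPrime box),
      ((g⁻¹ : GL (Fin k) (Afin box)) : Matrix (Fin k) (Fin k) (Afin box)).map (ev P) *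
        (g : Matrix (Fin k) (Fin k) (Afin box)).map (ev P) = 1 := fun P => by
    rw [← Matrix.map_mul, ← Units.val_mul, inv_mul_cancel, Units.val_one, Matrix.map_one _ (map_zero _) (map_one _)]
  have hdet : ∀ (p : ℕ) [Fact p.Prime], IsUnit (h p).det := by
    intro p _
    by_cases hp : p ∉ box
    · rw [h_good p hp]
      exact Matrix.isUnit_det_of_right_inverse (hinvmul ⟨p, Fact.out, hp⟩)
    · rw [h_bad p (not_not.mp hp), Matrix.det_one]; exact isUnit_one
  -- outside the prime factors of `N` (and outside `□`) the local matrix is in `GL_k(ℤ_p)`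
  have hout : ∀ (p : ℕ) [Fact p.Prime], p ∉ N.primeFactors →
      ∃ B : Matrix (Fin k) (Fin k) ℤ_[p], IsUnit B.det ∧ B.map PadicInt.Coe.ringHom = h p := by
    intro p _ hpT
    have hp : p.Prime := Fact.out
    by_cases hpb : p ∉ box
    · -- `p ∉ □`, `p ∤ N`: `(g⁻¹)_p = N⁻¹ M'_p` with `N ∈ ℤ_p^×`
      let P : GoodPrime box := ⟨p, hp, hpb⟩
      have hpN : ¬ p ∣ N := fun hd => hpT (Nat.mem_primeFactors.mpr ⟨hp, hd, hN.ne'⟩)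
      have hNu : IsUnit ((N : ℤ_[p])) := by
        rw [PadicInt.isUnit_iff, PadicInt.norm_natCast_eq_one_iff]
        exact (Nat.Prime.coprime_iff_not_dvd hp).mpr hpN
      obtain ⟨u, hu⟩ := hNu
      let Mp : Matrix (Fin k) (Fin k) ℤ_[p] := M.map (Pi.evalRingHom (fun q : GoodPrime box => Zp box q) P)
      let M'p : Matrix (Fin k) (Fin k) ℤ_[p] := M'.map (Pi.evalRingHom (fun q : GoodPrime box => Zp box q) P)
      have hM'pMp : M'p * Mp = Matrix.diagonal (fun _ : Fin k => (N : ℤ_[p]) * N) := by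
        simp only [Mp, M'p, ← Matrix.map_mul, hM'M, Matrix.diagonal_map (map_zero _), map_mul, map_natCast]
      refine ⟨Matrix.diagonal (fun _ : Fin k => ((u⁻¹ : ℤ_[p]ˣ) : ℤ_[p])) * M'p, ?_, ?_⟩
      · -- right inverse `diag(u⁻¹) M_p`
        refine Matrix.isUnit_det_of_right_inverse (B := Matrix.diagonal (fun _ : Fin k => ((u⁻¹ : ℤ_[p]ˣ) : ℤ_[p])) * Mp) ?_
        have hcomm : M'p * Matrix.diagonal (fun _ : Fin k => ((u⁻¹ : ℤ_[p]ˣ) : ℤ_[p])) =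
            Matrix.diagonal (fun _ : Fin k => ((u⁻¹ : ℤ_[p]ˣ) : ℤ_[p])) * M'p := by
          ext i j; simp [Matrix.mul_diagonal, Matrix.diagonal_mul, mul_comm]
        rw [Matrix.mul_assoc, ← Matrix.mul_assoc M'p, hcomm, Matrix.mul_assoc, hM'pMp, Matrix.diagonal_mul_diagonal,
          Matrix.diagonal_mul_diagonal, ← Matrix.diagonal_one]
        congr 1
        funext i
        simp only [← hu, Units.inv_mul_cancel_left, Units.inv_mul]
      · -- it maps to `(g⁻¹)_p`
        rw [h_good p hpb]
        ext i j
        have e1 := congrArg (ev P) (hM' i j)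
        rw [hev', map_mul, map_natCast] at e1
        -- `e1 : ↑(M' i j P) = N * ev (g⁻¹ i j)`
        have hNQ : (N : ℚ_[p]) ≠ 0 := Nat.cast_ne_zero.mpr hN.ne'
        rw [Matrix.map_apply, Matrix.map_apply, Matrix.diagonal_mul]
        show ((((u⁻¹ : ℤ_[p]ˣ) : ℤ_[p]) * M' i j P : ℤ_[p]) : ℚ_[p]) = ev P (((g⁻¹ : GL (Fin k) (Afin box)) : Matrix _ _ _) i j)
        have hcoeinv : ((((u⁻¹ : ℤ_[p]ˣ) : ℤ_[p])) : ℚ_[p]) = ((N : ℚ_[p]))⁻¹ := by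
          apply eq_inv_of_mul_eq_one_left
          have h1 : (((u⁻¹ : ℤ_[p]ˣ) : ℤ_[p]) * (u : ℤ_[p]) : ℤ_[p]) = 1 := Units.inv_mul u
          have h2 := congrArg (fun z : ℤ_[p] => (z : ℚ_[p])) h1
          simpa [hu] using h2
        rw [PadicInt.coe_mul, hcoeinv, inv_mul_eq_iff_eq_mul₀ hNQ]
        exact e1
    · exact ⟨1, by rw [Matrix.det_one]; exact isUnit_one, by
        rw [h_bad p (not_not.mp hpb), Matrix.map_one _ (map_zero _) (map_one _)]⟩
  -- CLASS NUMBER ONE (★ `LocalGlobalLattice`): one rational `γ` with `γ = U_p h_p`, `U_p ∈ GL_k(ℤ_p)`, for every prime `p`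
  obtain ⟨γ, hγ, hU⟩ := Literature.Algebra.Module.exists_rat_matrix_mem_integral_coset N.primeFactors
    (fun q hq => Nat.prime_of_mem_primeFactors hq) h hdet hout
  have hγunit : IsUnit γ.det := isUnit_iff_ne_zero.mpr hγ
  choose U hUdet hγU using hU
  -- notation for the `p`-adic images
  have hγP_inv : ∀ (p : ℕ) [Fact p.Prime],
      (γ.map fun x : ℚ => (x : ℚ_[p])) * (γ⁻¹.map fun x : ℚ => (x : ℚ_[p])) = 1 := by
    intro p _
    rw [show (fun x : ℚ => (x : ℚ_[p])) = (Rat.castHom ℚ_[p] : ℚ → ℚ_[p]) from rfl, ← Matrix.map_mul,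
      Matrix.mul_nonsing_inv γ hγunit, Matrix.map_one _ (map_zero _) (map_one _)]
  have hUV : ∀ (p : ℕ) [Fact p.Prime], (U p).map PadicInt.Coe.ringHom * ((U p)⁻¹).map PadicInt.Coe.ringHom = 1 := by
    intro p _
    rw [← Matrix.map_mul, Matrix.mul_nonsing_inv _ (hUdet p), Matrix.map_one _ (map_zero _) (map_one _)]
  -- the global matrix `U = (U_p)_{p ∉ □} ∈ GL_k(Ẑ^□)`
  let Ug : Matrix (Fin k) (Fin k) (Zhat box) := fun i j P => @U P.1 ⟨P.2.1⟩ i j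
  let Vg : Matrix (Fin k) (Fin k) (Zhat box) := fun i j P => (@U P.1 ⟨P.2.1⟩)⁻¹ i j
  have hUgP : ∀ P : GoodPrime box, Ug.map (Pi.evalRingHom (fun q : GoodPrime box => Zp box q) P) = @U P.1 ⟨P.2.1⟩ :=
    fun P => rfl
  have hVgP : ∀ P : GoodPrime box, Vg.map (Pi.evalRingHom (fun q : GoodPrime box => Zp box q) P) = (@U P.1 ⟨P.2.1⟩)⁻¹ :=
    fun P => rfl
  have hUgVg : Ug * Vg = 1 := matrix_eq_of_forall_component_eq box fun P => by
    haveI : Fact P.1.Prime := ⟨P.2.1⟩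
    rw [Matrix.map_mul, hUgP, hVgP, Matrix.map_one _ (map_zero _) (map_one _)]
    exact Matrix.mul_nonsing_inv _ (hUdet P.1)
  have hVgUg : Vg * Ug = 1 := matrix_eq_of_forall_component_eq box fun P => by
    haveI : Fact P.1.Prime := ⟨P.2.1⟩
    rw [Matrix.map_mul, hUgP, hVgP, Matrix.map_one _ (map_zero _) (map_one _)]
    exact Matrix.nonsing_inv_mul _ (hUdet P.1)
  let g₂ : GL (Fin k) (Zhat box) := ⟨Ug, Vg, hUgVg, hVgUg⟩
  have hcoe₂ : ((toAfin box k g₂ : GL (Fin k) (Afin box)) : Matrix (Fin k) (Fin k) (Afin box)) =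
      Ug.map (algebraMap (Zhat box) (Afin box)) := rfl
  have hcoe₂inv : (((toAfin box k g₂)⁻¹ : GL (Fin k) (Afin box)) : Matrix (Fin k) (Fin k) (Afin box)) =
      Vg.map (algebraMap (Zhat box) (Afin box)) := by
    rw [← map_inv]; rfl
  refine ⟨g * (toAfin box k g₂)⁻¹, fun i j => ⟨?_, ?_⟩, g₂, by rw [inv_mul_cancel_right]⟩
  · -- the entries of `g₁ = g U⁻¹` evaluate to those of `γ⁻¹` at every `p ∉ □`, and `γ⁻¹ ∈ GL_k(ℤ_p)` for `p ∈ □`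
    refine isBoxRational_of_forall_eval_eq box ev hev (r := γ⁻¹ i j) (fun p hp hdvd => ?_) (fun P => ?_)
    · -- denominator prime to `□`
      haveI : Fact p.Prime := ⟨hbox p hp⟩
      refine not_dvd_den_of_norm_le_one (p := p) ?_ hdvd
      -- `γ⁻¹_p = (U_p)⁻¹` is integral
      have hγp : (γ.map fun x : ℚ => (x : ℚ_[p])) = (U p).map PadicInt.Coe.ringHom := by
        rw [hγU p, h_bad p hp, Matrix.mul_one]
      have hγinvp : (γ⁻¹.map fun x : ℚ => (x : ℚ_[p])) = ((U p)⁻¹).map PadicInt.Coe.ringHom := by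
        have := hγP_inv p
        rw [hγp] at this
        rw [← Matrix.inv_eq_right_inv this, Matrix.inv_eq_right_inv (hUV p)]
      have := congr_fun (congr_fun hγinvp i) j
      rw [Matrix.map_apply, Matrix.map_apply] at this
      rw [this]
      exact PadicInt.norm_le_one _
    · haveI : Fact P.1.Prime := ⟨P.2.1⟩
      have hPb : P.1 ∉ box := P.2.2
      -- `γ_p g_p = U_p`, hence `g_p (U_p)⁻¹ = γ_p⁻¹ = (γ⁻¹)_p`
      have hγp : (γ.map fun x : ℚ => (x : ℚ_[P.1])) * (g : Matrix (Fin k) (Fin k) (Afin box)).map (ev P) =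
          (U P.1).map PadicInt.Coe.ringHom := by
        rw [hγU P.1, h_good P.1 hPb, Matrix.mul_assoc]
        erw [hinvmul P]
        rw [Matrix.mul_one]
      have hkey : (g : Matrix (Fin k) (Fin k) (Afin box)).map (ev P) * ((U P.1)⁻¹).map PadicInt.Coe.ringHom =
          γ⁻¹.map fun x : ℚ => (x : ℚ_[P.1]) := by
        rw [← Matrix.inv_eq_right_inv (hγP_inv P.1)]
        refine (Matrix.inv_eq_right_inv ?_).symm
        rw [← Matrix.mul_assoc, hγp, hUV P.1]
      have := congr_fun (congr_fun hkey i) j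
      rw [Matrix.map_apply] at this
      rw [← this, Units.val_mul, hcoe₂inv, Matrix.mul_apply, Matrix.mul_apply, map_sum]
      refine Finset.sum_congr rfl fun l _ => ?_
      rw [map_mul, Matrix.map_apply, Matrix.map_apply, Matrix.map_apply, hev']
      rfl
  · refine isBoxRational_of_forall_eval_eq box ev hev (r := γ i j) (fun p hp hdvd => ?_) (fun P => ?_)
    · haveI : Fact p.Prime := ⟨hbox p hp⟩
      refine not_dvd_den_of_norm_le_one (p := p) ?_ hdvd
      have hγp : (γ.map fun x : ℚ => (x : ℚ_[p])) = (U p).map PadicInt.Coe.ringHom := by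
        rw [hγU p, h_bad p hp, Matrix.mul_one]
      have := congr_fun (congr_fun hγp i) j
      rw [Matrix.map_apply, Matrix.map_apply] at this
      rw [this]
      exact PadicInt.norm_le_one _
    · haveI : Fact P.1.Prime := ⟨P.2.1⟩
      have hPb : P.1 ∉ box := P.2.2
      -- `(g₁⁻¹)_p = U_p (g⁻¹)_p = γ_p`
      have hkey : (U P.1).map PadicInt.Coe.ringHom *
          ((g⁻¹ : GL (Fin k) (Afin box)) : Matrix (Fin k) (Fin k) (Afin box)).map (ev P) =
          γ.map fun x : ℚ => (x : ℚ_[P.1]) := by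
        rw [hγU P.1, h_good P.1 hPb]
      have := congr_fun (congr_fun hkey i) j
      rw [Matrix.map_apply] at this
      rw [← this, _root_.mul_inv_rev, inv_inv, Units.val_mul, hcoe₂, Matrix.mul_apply, Matrix.mul_apply, map_sum]
      refine Finset.sum_congr rfl fun l _ => ?_
      rw [map_mul, Matrix.map_apply, Matrix.map_apply, Matrix.map_apply, hev']
      rfl

end Approximation5436

/-- **Lemma 5.4.3.6 (its closed content) DISCHARGED** — RULING TS-1 pay-down of ★ `Lan2013_5436_approximationGL` (ED. 2 letter, standing
hypothesis «`□` a set of rational primes»): `GL_k(𝔸^{∞,□}) = GL_k(ℤ_{(□)}) · GL_k(Ẑ^□)`.  Print (p. 370): «we have the approximations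
`GL(X ⊗ 𝔸^{∞,□}) = GL(X ⊗ ℤ_{(□)}) · GL(X ⊗ Ẑ^□)` … by elementary lattice theory»; the lattice theory is ★ `Literature.Algebra.Module.LocalGlobalLattice`
(class number one of `GL_k` over `ℚ`: `Submodule.basisOfPid` over the PID `ℤ` + `p`-adic approximation), transported to Lan's `Ẑ^□ = Π_{p ∉ □} ℤ_p`
and `𝔸^{∞,□}` by `exists_boxRational_mul_integral`. [cite: Lan2013PELCompactifications, Lem. 5.4.3.6, proof (p. 370; 2010 rev. p. 414)] -/
theorem Lan2013_5436_approximationGL_holds : Lan2013_5436_approximationGL := by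
  intro box hbox k g
  exact exists_boxRational_mul_integral box hbox k g

end Literature.AlgebraicGeometry.ModuliOfAbelianVarieties.Lan2013.Sec543HeckeCuspLabels
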